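import Literature.NumberTheory.EllipticCurves.PAdicHeightsLogProofs
import Mathlib.FieldTheory.Finite.Basic
import HarnessLib

/-!
# `‖log_p x‖ = ‖u^{p−1} − 1‖` for the Iwasawa logarithm, `x = p^k · u`, `p` odd
# (Iwasawa 1972 §4.4; Bhargava–Skinner–Zhang Lemma 18)

Source: K. Iwasawa, *Lectures on `p`-adic `L`-functions* (1972) [Iwasawa1972PadicL], §4.4: the
logarithm is an isometry on `1 + pℤ_p` for odd `p` (the tree's `norm_padicLogSeries_eq`), and
`log_p x = (p−1)⁻¹ · log_p(u^{p−1})` for `x = p^{ord_p x} · u` (the tree's DEFINITION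
`Literature.NumberTheory.EllipticCurves.padicLog`). Hence, for `p` odd and `x ≠ 0`,

> `‖log_p x‖_p = ‖u^{p−1} − 1‖_p`, `u = x · p^{−ord_p x}`,

i.e. `ord_p log_p x = ord_p(u^{p−1} − 1) ≥ 1` — the quantity Bhargava–Skinner–Zhang read off
`Δ(A,B)/p^k mod p²` in the proof of Lemma 18 (arXiv:1407.1826, p. 9: "`log_p q ∈ pℤ_pˣ` if and
only if …"), and Skinner–Zhang's hypothesis (b) "`log_p q_E ∈ pℤ_pˣ`".

Attribution note (the cell's referee desks, 2026-08-24: referee A R214.5 (3), REFEREE 3 R3.1224):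
[Iwasawa1972PadicL] (Ann. of Math. Studies 74) is NOT held by the cell, so its §4.4 locator is
provenance read from memory, not by page; everything attributed to it here is PROVED in this file
and in `PAdicHeightsLogProofs` (`norm_padicLogSeries_eq`). Held, page-verified loci for the
ingredients: the Iwasawa-normalised logarithm (`log_p p = 0`, functional equation, the series on
`|z − 1| < 1`) — J. W. S. Cassels, *Local Fields* (LMS Student Texts 3, 1986), Ch. 12 §2 and
Lemma 2.1 (pp. 281–282) [Cassels1986]; `ℤ_pˣ = V × U₁` — Serre, *A Course in Arithmetic*, Ch. II
§3.1 Prop. 7 [Serre1973]; the criterion as used at `p = 5` — Bhargava–Skinner–Zhang, proof of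
Lemma 18 (arXiv:1407.1826 p. 9, L11–14 of the held text) [BhargavaSkinnerZhang2014].

Consumer (why it is here): the BSD-DENSITY sprint's 5-adic seam (cell book
`cells/density/C0-SPEC.md`, G9, last step): with
`valuation_lInvariant_eq_valuation_padicLog_of_not_dvd`
(`ord₅ 𝓛(E) = ord₅ log₅ q_E` when `5 ∤ ord₅ Δ_min`) this file gives
`ord₅ 𝓛(E) = ord₅((q_E/5^k)⁴ − 1)`, so the `S₁′(5)` clause "`ord₅ 𝓛(E) = 1`" reads
"`(q_E/5^k)⁴ ≢ 1 (mod 25)`" — the complement of the four fourth roots of unity `±1, ±7 (mod 25)`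
(cf. `PadicPthPowerCriterionProofs`: the SAME residue set decides `q_E ∈ (ℚ₅ˣ)⁵`).

Contents (theorems only; 0 definitions, 0 named facts):
* (private) `norm_unitPart_eq_one` — `‖x · p^{−ord_p x}‖ = 1` for `x ≠ 0`;
* `norm_pow_sub_one_lt_one_of_norm_eq_one` — `‖u^{p−1} − 1‖ < 1` for `‖u‖ = 1` (Fermat);
* `norm_padicLog_eq_norm_unitPart_pow_sub_one` — **`‖log_p x‖ = ‖u^{p−1} − 1‖`** (`p` odd, `x ≠ 0`);
* `valuation_padicLog_eq` — the same in valuations: `ord_p log_p x = ord_p(u^{p−1} − 1)`.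
-/

noncomputable section

open IsUltrametricDist

namespace Literature.NumberTheory.EllipticCurves

variable {p : ℕ} [hp : Fact p.Prime]

/-- The unit part `u = x · p^{−ord_p x}` of `x ≠ 0` has norm `1`. [folklore] -/
private theorem norm_unitPart_eq_one {x : ℚ_[p]} (hx : x ≠ 0) :
    ‖x * (p : ℚ_[p]) ^ (-x.valuation)‖ = 1 := by
  have hp0 : (p : ℝ) ≠ 0 := by exact_mod_cast hp.out.ne_zero
  rw [norm_mul, Padic.norm_p_zpow, Padic.norm_eq_zpow_neg_valuation hx, neg_neg, ← zpow_add₀ hp0,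
    neg_add_cancel, zpow_zero]

/-- **Fermat in `ℤ_pˣ`**: for `‖u‖ = 1`, `‖u^{p−1} − 1‖ < 1` (the residue of `u` is a nonzero
element of `𝔽_p`, whose `(p−1)`-st power is `1`; Serre, *A Course in Arithmetic* II §3.1).
[cite: Serre1973, Ch. II §3.1 Prop. 7 (U/U₁ ≅ 𝔽_pˣ)] -/
theorem norm_pow_sub_one_lt_one_of_norm_eq_one {u : ℚ_[p]} (hu : ‖u‖ = 1) :
    ‖u ^ (p - 1) - 1‖ < 1 := by
  set U : ℤ_[p] := ⟨u, hu.le⟩ with hU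
  have hUu : IsUnit U := PadicInt.isUnit_iff.mpr hu
  have hU0 : PadicInt.toZMod U ≠ 0 := (hUu.map (PadicInt.toZMod (p := p))).ne_zero
  have h1 : PadicInt.toZMod (U ^ (p - 1) - 1) = 0 := by
    rw [map_sub, map_pow, map_one, ZMod.pow_card_sub_one_eq_one hU0, sub_self]
  have h2 : U ^ (p - 1) - 1 ∈ RingHom.ker (PadicInt.toZMod (p := p)) := h1
  rw [PadicInt.ker_toZMod, IsLocalRing.mem_maximalIdeal, mem_nonunits_iff,
    PadicInt.isUnit_iff] at h2
  have hle : ‖U ^ (p - 1) - 1‖ ≤ 1 := PadicInt.norm_le_one _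
  have hlt : ‖U ^ (p - 1) - 1‖ < 1 := lt_of_le_of_ne hle h2
  have hcoe : ((U ^ (p - 1) - 1 : ℤ_[p]) : ℚ_[p]) = u ^ (p - 1) - 1 := by
    push_cast; rw [hU]
  rw [← hcoe, PadicInt.padic_norm_e_of_padicInt]
  exact hlt

/-- **`‖log_p x‖ = ‖u^{p−1} − 1‖` for `p` odd**, `x ≠ 0`, `u = x · p^{−ord_p x}` its unit part
(Iwasawa logarithm: `log_p x = (p−1)⁻¹ L(u^{p−1})` with `L` an isometry on `1 + pℤ_p`,
`norm_padicLogSeries_eq`; `‖p − 1‖_p = 1`). Equivalently `ord_p log_p x = ord_p(u^{p−1} − 1)`;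
in particular "`log_p x ∈ pℤ_pˣ`" iff `u^{p−1} ≢ 1 (mod p²)` (Bhargava–Skinner–Zhang, proof of
Lemma 18; Skinner–Zhang Thm 1.1 hypothesis (b)).
[cite: Iwasawa1972PadicL, §4.4] [cite: BhargavaSkinnerZhang2014, Lemma 18 (proof, p. 9)] -/
theorem norm_padicLog_eq_norm_unitPart_pow_sub_one (hp2 : p ≠ 2) {x : ℚ_[p]} (hx : x ≠ 0) :
    ‖padicLog p x‖ = ‖(x * (p : ℚ_[p]) ^ (-x.valuation)) ^ (p - 1) - 1‖ := by
  set u : ℚ_[p] := x * (p : ℚ_[p]) ^ (-x.valuation) with hu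
  have hu1 : ‖u‖ = 1 := norm_unitPart_eq_one hx
  -- `‖(p : ℚ_p) − 1‖ = 1`
  have hp1 : ‖(p : ℚ_[p]) - 1‖ = 1 := by
    have hcast : (p : ℚ_[p]) - 1 = ((p - 1 : ℕ) : ℚ_[p]) := by
      rw [Nat.cast_sub hp.out.one_le, Nat.cast_one]
    rw [hcast, Padic.norm_natCast_eq_one_iff]
    exact (Nat.coprime_self_sub_right hp.out.one_le).mpr (Nat.coprime_one_right p)
  -- `‖1 − u^{p−1}‖ < ‖2‖ = 1`
  have h2 : ‖(2 : ℚ_[p])‖ = 1 := by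
    have : ((2 : ℕ) : ℚ_[p]) = 2 := by norm_num
    rw [← this, Padic.norm_natCast_eq_one_iff]
    exact (Nat.coprime_primes hp.out Nat.prime_two).mpr hp2
  have hy : ‖1 - u ^ (p - 1)‖ < ‖(2 : ℚ_[p])‖ := by
    rw [h2, norm_sub_rev]
    exact norm_pow_sub_one_lt_one_of_norm_eq_one hu1
  rw [padicLog, if_neg hx, norm_mul, norm_inv, hp1, inv_one, one_mul, ← hu,
    norm_padicLogSeries_eq hy, norm_sub_rev]

/-- The valuation form: for `p` odd, `x ≠ 0` and `u^{p−1} ≠ 1` (`u` the unit part of `x`),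
`ord_p log_p x = ord_p(u^{p−1} − 1)`. [cite: Iwasawa1972PadicL, §4.4] -/
theorem valuation_padicLog_eq (hp2 : p ≠ 2) {x : ℚ_[p]} (hx : x ≠ 0)
    (hne : (x * (p : ℚ_[p]) ^ (-x.valuation)) ^ (p - 1) - 1 ≠ 0) :
    (padicLog p x).valuation = ((x * (p : ℚ_[p]) ^ (-x.valuation)) ^ (p - 1) - 1).valuation := by
  have h := norm_padicLog_eq_norm_unitPart_pow_sub_one hp2 hx
  have hlog : padicLog p x ≠ 0 := by
    intro h0; rw [h0, norm_zero] at h; exact hne (norm_eq_zero.mp h.symm)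
  rw [Padic.norm_eq_zpow_neg_valuation hlog, Padic.norm_eq_zpow_neg_valuation hne] at h
  have hp0 : (0 : ℝ) < p := by exact_mod_cast hp.out.pos
  have hp1 : (p : ℝ) ≠ 1 := by exact_mod_cast hp.out.ne_one
  have := zpow_right_injective₀ hp0 hp1 h
  linarith

end Literature.NumberTheory.EllipticCurves

end
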